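import Summits.BirchSwinnertonDyer.BirchSwinnertonDyer.Theorems.ResidualThetaTransportAtTwoResidualThetaMainConjectureAtTwoMazurTateElementKThreeTerm
import Summits.BirchSwinnertonDyer.BirchSwinnertonDyer.Theorems.ResidualThetaTransportAtTwoResidualThetaMainConjectureAtTwoLimitFree
import Literature.NumberTheory.EllipticCurves.SharpFlatPAdicLFunctionCoeffField
import Literature.NumberTheory.EllipticCurves.PadicCoeffIntegersFrobeniusData
import Literature.NumberTheory.Automorphic.PadicIntermediateFieldUnitBall
import HarnessLib

/-!
# Crux `ResidualThetaMainConjectureAtTwo` (stmt-BirchSwinnertonDyer-20787), line `birth` v5 — toward stub (R1c)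
# `stub_pollackPairKAtTwo`: CONSTRUCTION of the signed functions `L^∓ ∈ 𝓞⟦T⟧` of a newform with Hecke field `K_g`
# at a prime with `a_p(g) = 0`, at a COHOMOLOGICAL period (Pollack 2003 Prop. 6.18 over `𝓞 = 𝓞_{ℚ_p(ι K_g)}`)

Cell `bsd-wall`, seat `bsd-wall-rtt-p2` (LEAD PROVER, line mode, g2). THEOREMS ONLY (no `def`, no named fact, no
`sorry`); `--supports stmt-BirchSwinnertonDyer-20787`; closes nothing by itself.

For a newform `g ∈ S₂(Γ₀(M))`, a prime `p ∤ M` with `a_p(g) = 0`, an embedding `ι : K_g → ℚ̄_p` and a COHOMOLOGICAL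
plus period `Ω` (PW Def. 2.1: all `ι[r]⁺_{g,Ω}` are `p`-integral), this file constructs `L⁻ ∈ 𝓞⟦T⟧`
(`𝓞 = padicCoeffIntegers (range ι)`) with the EXACT even-layer congruences
`θ_{2m}(g;Ω)^ι − (−1)^{m+1} ω⁻_{2m}·L⁻ ∈ ω_{2m}·𝓞⟦T⟧` for every `m` (`exists_isCongrModOmegaO_even`, exponent `0`
in `IsCongrModOmegaO`), and likewise `L⁺` with the odd-layer congruences (`exists_isCongrModOmegaO_odd`) — i.e.
the congruence half of `IsPollackPairK g ι Ω L⁺ L⁻`; the non-vanishing half (Rohrlich) is not done here.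
Construction, exactly as the tree's rational `exists_isCongrModOmega_even/odd` (Pollack Prop. 6.18 / Kobayashi
Thm. 3.2): `θ_n(g;Ω)^ι` lifts to `Θ_n ∈ 𝓞_E[T]`, `𝓞_E = unitBall p ℚ_p(ι K_g)` (cohomological period, PW Rem. 2.2);
`ω⁻_{2m} ∣ Θ_{2m}` and the quotients `(−1)^{m+1}Θ_{2m}/ω⁻_{2m}` are compatible modulo `T ω⁺_{2m}` (file
`…MazurTateElementKThreeTerm`, read in `𝓞_E[T]` by monic descent); `T ω⁺_{2m} = T ∏_{i<m} Φ_{p^{2i+2}}(1+T)` is a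
tower of Eisenstein-type polynomials, so the quotients converge in `𝓞_E⟦T⟧` (file `…LimitFree`, `𝓞_E` being finite
free over `ℤ_p` for `K_g` a number field — Shimura 3.48); finally `T ω⁺_{2m} ω⁻_{2m} = ω_{2m}` and
`𝓞_E = 𝓞` as subrings of `ℚ̄_p`. BSD is not proved by any of this.

Refs: [Pollack2003] Prop. 6.18; [Kobayashi2003] Thm. 3.2; [PollackWeston2011MT] Def. 2.1, Rem. 2.2.
-/

set_option linter.dupNamespace false
set_option autoImplicit false

noncomputable section

open scoped Classical MatrixGroups ModularForm

open CongruenceSubgroup Polynomial Literature.NumberTheory.EllipticCurves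
  Literature.NumberTheory.EllipticCurves.ModularForms Literature.NumberTheory.Automorphic

namespace Summit.BirchSwinnertonDyer.BirchSwinnertonDyer.Theorems.ResidualThetaLayer

/-! ## §1. `𝓞 = padicCoeffIntegers (range ι)` is the unit ball of `ℚ_p(ι K_g)`; lifts of `θ_n(g; Ω)^ι` -/

section UnitBall

variable {p : ℕ} [Fact p.Prime]

/-- The two carriers of `𝓞 = {x ∈ ℚ_p(S) : |x| ≤ 1}` agree: `padicCoeffIntegers S = unitBall p (padicCoeffField S)` as
subrings of `ℚ̄_p` (`Valued.v x = ‖x‖₊`). [folklore] -/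
theorem padicCoeffIntegers_eq_unitBall (S : Set (PadicAlgCl p)) :
    padicCoeffIntegers S = PadicIntermediateField.unitBall p (padicCoeffField S) := by
  ext x
  rw [mem_padicCoeffIntegers_iff, PadicIntermediateField.mem_unitBall_iff, PadicAlgCl.valuation_def]
  constructor
  · rintro ⟨h1, h2⟩; exact ⟨h1, by exact_mod_cast h2⟩
  · rintro ⟨h1, h2⟩; exact ⟨h1, by exact_mod_cast h2⟩

variable {M : ℕ} [NeZero M] {g : CuspForm (Gamma0 M) 2} (ι : coeffField g →+* PadicAlgCl p) {Ω : ℂ}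

omit [NeZero M] in
/-- **At a cohomological period `θ_n(g; Ω)^ι` lifts to the unit ball of `ℚ_p(ι K_g)`** (PW Rem. 2.2: integral
coefficients; and every coefficient lies in `ι(K_g) ⊆ ℚ_p(ι K_g)`). [cite: PollackWeston2011MT, Rem. 2.2] -/
theorem exists_map_eq_map_mazurTateElementK (hΩ : IsCohomologicalPlusPeriod g ι Ω) (n : ℕ) :
    ∃ Θ : (PadicIntermediateField.unitBall p (padicCoeffField (Set.range ι)))[X],
      Θ.map (PadicIntermediateField.unitBall p (padicCoeffField (Set.range ι))).subtype =
        (mazurTateElementK g Ω p n).map ι := by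
  have h : (mazurTateElementK g Ω p n).map ι ∈
      Polynomial.lifts (PadicIntermediateField.unitBall p (padicCoeffField (Set.range ι))).subtype := by
    rw [lifts_iff_coeff_lifts]
    intro j
    have hmem : ((mazurTateElementK g Ω p n).map ι).coeff j ∈
        PadicIntermediateField.unitBall p (padicCoeffField (Set.range ι)) := by
      rw [← padicCoeffIntegers_eq_unitBall, mem_padicCoeffIntegers_iff]
      refine ⟨?_, hΩ.norm_coeff_map_mazurTateElementK_le_one n j⟩
      rw [coeff_map]
      exact IntermediateField.subset_adjoin ℚ_[p] _ ⟨_, rfl⟩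
    exact ⟨⟨_, hmem⟩, rfl⟩
  obtain ⟨Θ, hΘ⟩ := (mem_lifts _).mp h
  exact ⟨Θ, hΘ⟩

end UnitBall

/-! ## §2. Monic descent along an injective ring map -/

section Descent

variable {R S : Type*} [CommRing R] [CommRing S] (j : R →+* S)

/-- Exact division: if the monic `D` divides `P` then `D · (P /ₘ D) = P`. [folklore] -/
theorem mul_divByMonic_eq_of_dvd'' {D P : R[X]} (hD : D.Monic) (h : D ∣ P) : D * (P /ₘ D) = P := by
  have h1 := modByMonic_add_div P D
  rwa [(modByMonic_eq_zero_iff_dvd hD).mpr h, zero_add] at h1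

/-- The constant term of `Φ_{p^{k+1}}(1+T)` is `Φ_{p^{k+1}}(1) = p`. [folklore] -/
theorem dvd_coeff_zero_cyclotomic_comp' (p : ℕ) [hp : Fact p.Prime] (k : ℕ) :
    (p : ℤ_[p]) ∣ (((cyclotomic (p ^ (k + 1)) ℤ).comp (X + 1)).map (Int.castRingHom ℤ_[p])).coeff 0 := by
  rw [coeff_map, coeff_zero_eq_eval_zero, eval_comp, eval_add, eval_X, eval_one, zero_add,
    eval_one_cyclotomic_prime_pow, map_natCast]

/-- The algebraic identity behind the congruence: if `Θ = Ω⁻ q`, `g = σ q` with `σ² = 1`,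
`L − g = B Ω⁺' Q` and `Ω = B Ω⁺' Ω⁻`, then `Θ − σ Ω⁻ L = Ω (−σ Q)`. [folklore] -/
theorem sub_mul_eq_of_identities' {T : Type*} [CommRing T] {Θ Ωm Ωp B q g L Q Ω σ : T}
    (hσ : σ * σ = 1) (hΘ : Θ = Ωm * q) (hg : g = σ * q) (hL : L - g = B * Ωp * Q)
    (hΩ : Ω = B * Ωp * Ωm) : Θ - σ * Ωm * L = Ω * -(σ * Q) := by
  have hL' : L = g + B * Ωp * Q := by rw [← hL]; ring
  rw [hL', hg, hΘ, hΩ]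
  linear_combination (-(Ωm * q)) * hσ

end Descent

/-! ## §3. Construction of `L⁻` (even layers) and `L⁺` (odd layers) at a cohomological period -/

section Construction

variable {M : ℕ} [NeZero M] {g : CuspForm (Gamma0 M) 2} {p : ℕ} [hp : Fact p.Prime]
  {ι : coeffField g →+* PadicAlgCl p} {Ω : ℂ}

/-- **Existence of `L⁻ ∈ 𝓞⟦T⟧` with the even-layer congruences, at a cohomological period.** For a newform
`g ∈ S₂(Γ₀(M))`, `p ∤ M`, `a_p(g) = 0`, an embedding `ι` and a cohomological plus period `Ω`, there is
`L⁻ ∈ 𝓞⟦T⟧` (`𝓞 = padicCoeffIntegers (range ι)`) with `θ_{2m}(g;Ω)^ι ≡ (−1)^{m+1} ω⁻_{2m} L⁻ (mod ω_{2m} 𝓞⟦T⟧)`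
for every `m` — the shape `IsCongrModOmegaO` with exponent `0` (Pollack 2003 Prop. 6.18, even levels, over `𝓞`).
[cite: Pollack2003, Prop. 6.18] [cite: PollackWeston2011MT, Rem. 2.2] -/
theorem exists_isCongrModOmegaO_even (hg : IsNewform0 g) (hΩ : IsCohomologicalPlusPeriod g ι Ω)
    (hpM : ¬ p ∣ M) (hap : cuspCoeff g p = 0) :
    ∃ L : IwasawaAlgebraO (Set.range ι), ∀ m : ℕ,
      IsCongrModOmegaO (Set.range ι) (2 * m) ((mazurTateElementK g Ω p (2 * m)).map ι)
        (((((-1) ^ (m + 1) * cyclotomicOmegaMinus p (2 * m)).map (Int.castRingHom (PadicAlgCl p)) :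
            (PadicAlgCl p)[X]) : PowerSeries (PadicAlgCl p)) * iwasawaOToPowerSeries (Set.range ι) L) := by
  classical
  -- the coefficient ring `𝓞_E = unitBall p E`, `E = ℚ_p(ι K_g)`, finite free over `ℤ_p`
  set E : IntermediateField ℚ_[p] (PadicAlgCl p) := padicCoeffField (Set.range ι) with hE
  haveI : FiniteDimensional ℚ (coeffField g) := IsNewform0.finiteDimensional_coeffField_holds hg
  haveI : FiniteDimensional ℚ_[p] E := GreenbergSelmer.finiteDimensional_padicCoeffField ι
  set O := PadicIntermediateField.unitBall p E with hO
  set jO : O →+* PadicAlgCl p := O.subtype with hjO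
  have hjO_inj : Function.Injective jO := Subtype.val_injective
  have hjO_int : jO.comp (Int.castRingHom O) = Int.castRingHom (PadicAlgCl p) := RingHom.ext_int _ _
  have hιK : ι.comp (Int.castRingHom (coeffField g)) = Int.castRingHom (PadicAlgCl p) := RingHom.ext_int _ _
  have hIsP : IsPlusPeriod g Ω := hΩ.isPlusPeriod
  -- lifts of the Mazur–Tate elements
  choose Θ hΘ using fun n ↦ exists_map_eq_map_mazurTateElementK ι hΩ (p := p) n
  -- the polynomials over `𝓞_E`
  set Ωm : ℕ → O[X] := fun k ↦ (cyclotomicOmegaMinus p k).map (Int.castRingHom O) with hΩm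
  set Ωp : ℕ → O[X] := fun k ↦ (cyclotomicOmegaPlus p k).map (Int.castRingHom O) with hΩp
  have hmon : ∀ k, (Ωm k).Monic := fun k ↦ (monic_cyclotomicOmegaMinus p k).map _
  have hΩm_map : ∀ k, (Ωm k).map jO = (cyclotomicOmegaMinus p k).map (Int.castRingHom (PadicAlgCl p)) := by
    intro k; rw [hΩm]; dsimp only; rw [Polynomial.map_map, hjO_int]
  have hΩp_map : ∀ k, (Ωp k).map jO = (cyclotomicOmegaPlus p k).map (Int.castRingHom (PadicAlgCl p)) := by
    intro k; rw [hΩp]; dsimp only; rw [Polynomial.map_map, hjO_int]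
  -- a divisibility in `K_g[T]` by the image of a monic `D ∈ ℤ[T]` descends to `𝓞_E[T]` along `ι`
  have hdesc : ∀ {D : ℤ[X]} (hD : D.Monic) {P : (coeffField g)[X]} {Q : O[X]}
      (hQ : Q.map jO = P.map ι) (h : D.map (Int.castRingHom (coeffField g)) ∣ P),
      D.map (Int.castRingHom O) ∣ Q := by
    intro D hD P Q hQ h
    refine (Polynomial.map_dvd_map jO hjO_inj (hD.map _)).mp ?_
    rw [Polynomial.map_map, hjO_int, hQ, ← hιK, ← Polynomial.map_map]
    exact Polynomial.map_dvd ι h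
  -- `ω⁻_{2m} ∣ Θ_{2m}` in `𝓞_E[T]`
  have hdiv : ∀ m, Ωm (2 * m) ∣ Θ (2 * m) := fun m ↦
    hdesc (monic_cyclotomicOmegaMinus p _) (hΘ _) (cyclotomicOmegaMinus_dvd_mazurTateElementK hg hIsP hpM hap m)
  -- the signed quotients `g_m = (-1)^{m+1} Θ_{2m}/ω⁻_{2m}`
  set gq : ℕ → O[X] := fun m ↦ (-1) ^ (m + 1) * (Θ (2 * m) /ₘ Ωm (2 * m)) with hgq
  have hgmap : ∀ m, (gq m).map jO =
      ((-1) ^ (m + 1) * (mazurTateElementK g Ω p (2 * m) /ₘ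
        (cyclotomicOmegaMinus p (2 * m)).map (Int.castRingHom (coeffField g)))).map ι := by
    intro m
    rw [hgq]
    dsimp only
    rw [Polynomial.map_mul, Polynomial.map_mul, Polynomial.map_pow, Polynomial.map_pow,
      Polynomial.map_neg, Polynomial.map_neg, Polynomial.map_one, Polynomial.map_one,
      Polynomial.map_divByMonic _ (hmon _), Polynomial.map_divByMonic _
        ((monic_cyclotomicOmegaMinus p _).map _), hΘ, hΩm_map, Polynomial.map_map, hιK]
  -- compatibility `T ω⁺_{2m} ∣ g_{m+1} − g_m` in `𝓞_E[T]`
  have hcompat : ∀ m, X * Ωp (2 * m) ∣ gq (m + 1) - gq m := by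
    intro m
    have hD : (X * cyclotomicOmegaPlus p (2 * m)).Monic := monic_X.mul (monic_cyclotomicOmegaPlus p _)
    have h1 : (X * cyclotomicOmegaPlus p (2 * m)).map (Int.castRingHom O) = X * Ωp (2 * m) := by
      rw [Polynomial.map_mul, Polynomial.map_X]
    rw [← h1]
    refine hdesc hD (P := (-1) ^ (m + 2) * (mazurTateElementK g Ω p (2 * (m + 1)) /ₘ
          (cyclotomicOmegaMinus p (2 * (m + 1))).map (Int.castRingHom (coeffField g))) -
        (-1) ^ (m + 1) * (mazurTateElementK g Ω p (2 * m) /ₘ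
          (cyclotomicOmegaMinus p (2 * m)).map (Int.castRingHom (coeffField g)))) ?_ ?_
    · rw [Polynomial.map_sub, hgmap, hgmap, ← Polynomial.map_sub, show m + 1 + 1 = m + 2 by ring]
    · rw [Polynomial.map_mul, Polynomial.map_X]
      exact X_mul_cyclotomicOmegaPlus_dvd_sub_minusK hg hIsP hpM hap m
  choose s hs using hcompat
  -- the tower `T ω⁺_{2m} = T ∏_{i<m} Φ_{p^{2i+2}}(1+T)`
  set ξ : ℕ → ℤ_[p][X] := fun i ↦
    ((cyclotomic (p ^ (2 * i + 2)) ℤ).comp (X + 1)).map (Int.castRingHom ℤ_[p]) with hξ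
  have hξ0 : ∀ i, (p : ℤ_[p]) ∣ (ξ i).coeff 0 := fun i ↦ by
    rw [hξ]
    dsimp only
    rw [show 2 * i + 2 = (2 * i + 1) + 1 by ring]
    exact dvd_coeff_zero_cyclotomic_comp' p _
  have halgint : (algebraMap ℤ_[p] O).comp (Int.castRingHom ℤ_[p]) = Int.castRingHom O := RingHom.ext_int _ _
  have hΩpξ : ∀ m, (X * ∏ i ∈ Finset.range m, ξ i).map (algebraMap ℤ_[p] O) = X * Ωp (2 * m) := fun m ↦ by
    rw [hΩp, hξ]
    dsimp only
    rw [cyclotomicOmegaPlus_two_mul_eq_prod, Polynomial.map_mul, Polynomial.map_X, Polynomial.map_prod,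
      Polynomial.map_prod]
    congr 1
    refine Finset.prod_congr rfl fun i _ ↦ ?_
    rw [Polynomial.map_map, halgint]
  obtain ⟨L', hL'⟩ := exists_powerSeries_sub_eq_mul_of_free X ξ hξ0 gq s fun m ↦ by rw [hΩpξ, hs]
  -- transfer `𝓞_E → 𝓞 = padicCoeffIntegers (range ι)` (equal subrings of `ℚ̄_p`)
  have hOU : O = padicCoeffIntegers (Set.range ι) := (padicCoeffIntegers_eq_unitBall (Set.range ι)).symm
  set e : O →+* padicCoeffIntegers (Set.range ι) := (RingEquiv.subringCongr hOU).toRingHom with he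
  have hje : (padicCoeffIntegers (Set.range ι)).subtype.comp e = jO := RingHom.ext fun _ ↦ rfl
  have hιO : ∀ F : PowerSeries O, iwasawaOToPowerSeries (Set.range ι) (PowerSeries.map e F) =
      PowerSeries.map jO F := fun F ↦ by
    rw [iwasawaOToPowerSeries, ← RingHom.comp_apply, ← PowerSeries.map_comp, hje]
  refine ⟨PowerSeries.map e L', fun m ↦ ?_⟩
  obtain ⟨Q, hLQ⟩ := hL' m
  rw [hΩpξ] at hLQ
  refine ⟨0, PowerSeries.map e (-((-1) ^ (m + 1) * Q)), ?_⟩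
  -- everything is the image under `𝓞_E⟦T⟧ → ℚ̄_p⟦T⟧` of an identity in `𝓞_E⟦T⟧`
  have hθ : ((((mazurTateElementK g Ω p (2 * m)).map ι : (PadicAlgCl p)[X])) : PowerSeries (PadicAlgCl p)) =
      PowerSeries.map jO (Θ (2 * m) : PowerSeries O) := by
    rw [← hΘ, Polynomial.polynomial_map_coe]
  have hω : (((((-1) ^ (m + 1) * cyclotomicOmegaMinus p (2 * m)).map (Int.castRingHom (PadicAlgCl p)) :
      (PadicAlgCl p)[X]) : PowerSeries (PadicAlgCl p))) =
      PowerSeries.map jO ((-1) ^ (m + 1) * (Ωm (2 * m) : PowerSeries O)) := by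
    rw [map_mul, map_pow, map_neg, map_one, ← Polynomial.polynomial_map_coe, hΩm_map, Polynomial.map_mul,
      Polynomial.map_pow, Polynomial.map_neg, Polynomial.map_one, Polynomial.coe_mul, Polynomial.coe_pow,
      Polynomial.coe_neg, Polynomial.coe_one]
  have hΩ : ((((cyclotomicOmega p (2 * m)).map (Int.castRingHom (PadicAlgCl p)) : (PadicAlgCl p)[X])) :
      PowerSeries (PadicAlgCl p)) =
      PowerSeries.map jO (((X : O[X]) : PowerSeries O) * (Ωp (2 * m) : PowerSeries O) * (Ωm (2 * m) : PowerSeries O)) := by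
    rw [map_mul, map_mul, ← Polynomial.polynomial_map_coe, ← Polynomial.polynomial_map_coe,
      ← Polynomial.polynomial_map_coe, hΩp_map, hΩm_map, Polynomial.map_X,
      ← X_mul_cyclotomicOmegaPlus_mul_cyclotomicOmegaMinus, Polynomial.map_mul, Polynomial.map_mul,
      Polynomial.map_X, Polynomial.coe_mul, Polynomial.coe_mul]
  have hΘq : (Θ (2 * m) : PowerSeries O) =
      (Ωm (2 * m) : PowerSeries O) * ((Θ (2 * m) /ₘ Ωm (2 * m) : O[X]) : PowerSeries O) := by
    rw [← Polynomial.coe_mul, mul_divByMonic_eq_of_dvd'' (hmon _) (hdiv m)]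
  have hgq' : (gq m : PowerSeries O) =
      (-1) ^ (m + 1) * ((Θ (2 * m) /ₘ Ωm (2 * m) : O[X]) : PowerSeries O) := by
    rw [hgq]
    dsimp only
    rw [Polynomial.coe_mul, Polynomial.coe_pow, Polynomial.coe_neg, Polynomial.coe_one]
  have hσ : ((-1 : PowerSeries O) ^ (m + 1)) * (-1) ^ (m + 1) = 1 := by
    rw [← mul_pow, neg_one_mul, neg_neg, one_pow]
  have hLQ' : L' - (gq m : PowerSeries O) =
      ((X : O[X]) : PowerSeries O) * (Ωp (2 * m) : PowerSeries O) * Q := by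
    rw [← Polynomial.coe_mul]
    exact hLQ
  have key := sub_mul_eq_of_identities' hσ hΘq hgq' hLQ' rfl
  rw [pow_zero, map_one, one_mul, hθ, hω, hιO, hιO, hΩ, ← map_mul, ← map_sub, ← map_mul, key]

/-- **Existence of `L⁺ ∈ 𝓞⟦T⟧` with the odd-layer congruences, at a cohomological period**: likewise there is
`L⁺ ∈ 𝓞⟦T⟧` with `θ_{2m+1}(g;Ω)^ι ≡ (−1)^{m+1} ω⁺_{2m+1} L⁺ (mod ω_{2m+1} 𝓞⟦T⟧)` for every `m`, as the limit of
`(−1)^{m+1} θ_{2m+1}/ω⁺_{2m+1}` along the tower `T ω⁻_{2m+1}` (Pollack 2003 Prop. 6.18, odd levels, over `𝓞`).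
[cite: Pollack2003, Prop. 6.18] [cite: PollackWeston2011MT, Rem. 2.2] -/
theorem exists_isCongrModOmegaO_odd (hg : IsNewform0 g) (hΩ : IsCohomologicalPlusPeriod g ι Ω)
    (hpM : ¬ p ∣ M) (hap : cuspCoeff g p = 0) :
    ∃ L : IwasawaAlgebraO (Set.range ι), ∀ m : ℕ,
      IsCongrModOmegaO (Set.range ι) (2 * m + 1) ((mazurTateElementK g Ω p (2 * m + 1)).map ι)
        (((((-1) ^ (m + 1) * cyclotomicOmegaPlus p (2 * m + 1)).map (Int.castRingHom (PadicAlgCl p)) :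
            (PadicAlgCl p)[X]) : PowerSeries (PadicAlgCl p)) * iwasawaOToPowerSeries (Set.range ι) L) := by
  classical
  -- the coefficient ring `𝓞_E = unitBall p E`, `E = ℚ_p(ι K_g)`, finite free over `ℤ_p`
  set E : IntermediateField ℚ_[p] (PadicAlgCl p) := padicCoeffField (Set.range ι) with hE
  haveI : FiniteDimensional ℚ (coeffField g) := IsNewform0.finiteDimensional_coeffField_holds hg
  haveI : FiniteDimensional ℚ_[p] E := GreenbergSelmer.finiteDimensional_padicCoeffField ι
  set O := PadicIntermediateField.unitBall p E with hO
  set jO : O →+* PadicAlgCl p := O.subtype with hjO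
  have hjO_inj : Function.Injective jO := Subtype.val_injective
  have hjO_int : jO.comp (Int.castRingHom O) = Int.castRingHom (PadicAlgCl p) := RingHom.ext_int _ _
  have hιK : ι.comp (Int.castRingHom (coeffField g)) = Int.castRingHom (PadicAlgCl p) := RingHom.ext_int _ _
  have hIsP : IsPlusPeriod g Ω := hΩ.isPlusPeriod
  -- lifts of the Mazur–Tate elements
  choose Θ hΘ using fun n ↦ exists_map_eq_map_mazurTateElementK ι hΩ (p := p) n
  -- the polynomials over `𝓞_E`
  set Ωm : ℕ → O[X] := fun k ↦ (cyclotomicOmegaMinus p k).map (Int.castRingHom O) with hΩm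
  set Ωp : ℕ → O[X] := fun k ↦ (cyclotomicOmegaPlus p k).map (Int.castRingHom O) with hΩp
  have hmon : ∀ k, (Ωp k).Monic := fun k ↦ (monic_cyclotomicOmegaPlus p k).map _
  have hΩm_map : ∀ k, (Ωm k).map jO = (cyclotomicOmegaMinus p k).map (Int.castRingHom (PadicAlgCl p)) := by
    intro k; rw [hΩm]; dsimp only; rw [Polynomial.map_map, hjO_int]
  have hΩp_map : ∀ k, (Ωp k).map jO = (cyclotomicOmegaPlus p k).map (Int.castRingHom (PadicAlgCl p)) := by
    intro k; rw [hΩp]; dsimp only; rw [Polynomial.map_map, hjO_int]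
  -- a divisibility in `K_g[T]` by the image of a monic `D ∈ ℤ[T]` descends to `𝓞_E[T]` along `ι`
  have hdesc : ∀ {D : ℤ[X]} (hD : D.Monic) {P : (coeffField g)[X]} {Q : O[X]}
      (hQ : Q.map jO = P.map ι) (h : D.map (Int.castRingHom (coeffField g)) ∣ P),
      D.map (Int.castRingHom O) ∣ Q := by
    intro D hD P Q hQ h
    refine (Polynomial.map_dvd_map jO hjO_inj (hD.map _)).mp ?_
    rw [Polynomial.map_map, hjO_int, hQ, ← hιK, ← Polynomial.map_map]
    exact Polynomial.map_dvd ι h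
  -- `ω⁺_{2m+1} ∣ Θ_{2m+1}` in `𝓞_E[T]`
  have hdiv : ∀ m, Ωp (2 * m + 1) ∣ Θ (2 * m + 1) := fun m ↦
    hdesc (monic_cyclotomicOmegaPlus p _) (hΘ _) (cyclotomicOmegaPlus_dvd_mazurTateElementK hg hIsP hpM hap m)
  -- the signed quotients `g_m = (-1)^{m+1} Θ_{2m+1}/ω⁺_{2m+1}`
  set gq : ℕ → O[X] := fun m ↦ (-1) ^ (m + 1) * (Θ (2 * m + 1) /ₘ Ωp (2 * m + 1)) with hgq
  have hgmap : ∀ m, (gq m).map jO =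
      ((-1) ^ (m + 1) * (mazurTateElementK g Ω p (2 * m + 1) /ₘ
        (cyclotomicOmegaPlus p (2 * m + 1)).map (Int.castRingHom (coeffField g)))).map ι := by
    intro m
    rw [hgq]
    dsimp only
    rw [Polynomial.map_mul, Polynomial.map_mul, Polynomial.map_pow, Polynomial.map_pow,
      Polynomial.map_neg, Polynomial.map_neg, Polynomial.map_one, Polynomial.map_one,
      Polynomial.map_divByMonic _ (hmon _), Polynomial.map_divByMonic _
        ((monic_cyclotomicOmegaPlus p _).map _), hΘ, hΩp_map, Polynomial.map_map, hιK]
  -- compatibility `T ω⁻_{2m+1} ∣ g_{m+1} − g_m` in `𝓞_E[T]`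
  have hcompat : ∀ m, X * Ωm (2 * m + 1) ∣ gq (m + 1) - gq m := by
    intro m
    have hD : (X * cyclotomicOmegaMinus p (2 * m + 1)).Monic := monic_X.mul (monic_cyclotomicOmegaMinus p _)
    have h1 : (X * cyclotomicOmegaMinus p (2 * m + 1)).map (Int.castRingHom O) = X * Ωm (2 * m + 1) := by
      rw [Polynomial.map_mul, Polynomial.map_X]
    rw [← h1]
    refine hdesc hD (P := (-1) ^ (m + 2) * (mazurTateElementK g Ω p (2 * (m + 1) + 1) /ₘ
          (cyclotomicOmegaPlus p (2 * (m + 1) + 1)).map (Int.castRingHom (coeffField g))) -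
        (-1) ^ (m + 1) * (mazurTateElementK g Ω p (2 * m + 1) /ₘ
          (cyclotomicOmegaPlus p (2 * m + 1)).map (Int.castRingHom (coeffField g)))) ?_ ?_
    · rw [Polynomial.map_sub, hgmap, hgmap, ← Polynomial.map_sub, show m + 1 + 1 = m + 2 by ring]
    · rw [Polynomial.map_mul, Polynomial.map_X]
      exact X_mul_cyclotomicOmegaMinus_dvd_sub_plusK hg hIsP hpM hap m
  choose s hs using hcompat
  -- the tower `T ω⁻_{2m+1} = (T Φ_p(1+T)) ∏_{i<m} Φ_{p^{2i+3}}(1+T)`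
  set B : ℤ_[p][X] := X * ((cyclotomic p ℤ).comp (X + 1)).map (Int.castRingHom ℤ_[p]) with hB
  set ξ : ℕ → ℤ_[p][X] := fun i ↦
    ((cyclotomic (p ^ (2 * i + 3)) ℤ).comp (X + 1)).map (Int.castRingHom ℤ_[p]) with hξ
  have hξ0 : ∀ i, (p : ℤ_[p]) ∣ (ξ i).coeff 0 := fun i ↦ by
    rw [hξ]
    dsimp only
    rw [show 2 * i + 3 = (2 * i + 2) + 1 by ring]
    exact dvd_coeff_zero_cyclotomic_comp' p _
  have halgint : (algebraMap ℤ_[p] O).comp (Int.castRingHom ℤ_[p]) = Int.castRingHom O := RingHom.ext_int _ _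
  have hΩpξ : ∀ m, (B * ∏ i ∈ Finset.range m, ξ i).map (algebraMap ℤ_[p] O) = X * Ωm (2 * m + 1) := fun m ↦ by
    rw [hΩm, hξ, hB]
    dsimp only
    rw [cyclotomicOmegaMinus_two_mul_add_one_eq_prod, Polynomial.map_mul, Polynomial.map_mul, Polynomial.map_mul,
      Polynomial.map_X, Polynomial.map_prod, Polynomial.map_prod, Polynomial.map_map, halgint, mul_assoc]
    congr 2
    refine Finset.prod_congr rfl fun i _ ↦ ?_
    rw [Polynomial.map_map, halgint]
  obtain ⟨L', hL'⟩ := exists_powerSeries_sub_eq_mul_of_free B ξ hξ0 gq s fun m ↦ by rw [hΩpξ, hs]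
  -- transfer `𝓞_E → 𝓞 = padicCoeffIntegers (range ι)` (equal subrings of `ℚ̄_p`)
  have hOU : O = padicCoeffIntegers (Set.range ι) := (padicCoeffIntegers_eq_unitBall (Set.range ι)).symm
  set e : O →+* padicCoeffIntegers (Set.range ι) := (RingEquiv.subringCongr hOU).toRingHom with he
  have hje : (padicCoeffIntegers (Set.range ι)).subtype.comp e = jO := RingHom.ext fun _ ↦ rfl
  have hιO : ∀ F : PowerSeries O, iwasawaOToPowerSeries (Set.range ι) (PowerSeries.map e F) =
      PowerSeries.map jO F := fun F ↦ by
    rw [iwasawaOToPowerSeries, ← RingHom.comp_apply, ← PowerSeries.map_comp, hje]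
  refine ⟨PowerSeries.map e L', fun m ↦ ?_⟩
  obtain ⟨Q, hLQ⟩ := hL' m
  rw [hΩpξ] at hLQ
  refine ⟨0, PowerSeries.map e (-((-1) ^ (m + 1) * Q)), ?_⟩
  -- everything is the image under `𝓞_E⟦T⟧ → ℚ̄_p⟦T⟧` of an identity in `𝓞_E⟦T⟧`
  have hθ : ((((mazurTateElementK g Ω p (2 * m + 1)).map ι : (PadicAlgCl p)[X])) : PowerSeries (PadicAlgCl p)) =
      PowerSeries.map jO (Θ (2 * m + 1) : PowerSeries O) := by
    rw [← hΘ, Polynomial.polynomial_map_coe]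
  have hω : (((((-1) ^ (m + 1) * cyclotomicOmegaPlus p (2 * m + 1)).map (Int.castRingHom (PadicAlgCl p)) :
      (PadicAlgCl p)[X]) : PowerSeries (PadicAlgCl p))) =
      PowerSeries.map jO ((-1) ^ (m + 1) * (Ωp (2 * m + 1) : PowerSeries O)) := by
    rw [map_mul, map_pow, map_neg, map_one, ← Polynomial.polynomial_map_coe, hΩp_map, Polynomial.map_mul,
      Polynomial.map_pow, Polynomial.map_neg, Polynomial.map_one, Polynomial.coe_mul, Polynomial.coe_pow,
      Polynomial.coe_neg, Polynomial.coe_one]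
  have hΩ : ((((cyclotomicOmega p (2 * m + 1)).map (Int.castRingHom (PadicAlgCl p)) : (PadicAlgCl p)[X])) :
      PowerSeries (PadicAlgCl p)) =
      PowerSeries.map jO (((X : O[X]) : PowerSeries O) * (Ωm (2 * m + 1) : PowerSeries O) *
        (Ωp (2 * m + 1) : PowerSeries O)) := by
    rw [map_mul, map_mul, ← Polynomial.polynomial_map_coe, ← Polynomial.polynomial_map_coe,
      ← Polynomial.polynomial_map_coe, hΩp_map, hΩm_map, Polynomial.map_X,
      ← X_mul_cyclotomicOmegaPlus_mul_cyclotomicOmegaMinus, Polynomial.map_mul, Polynomial.map_mul,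
      Polynomial.map_X, Polynomial.coe_mul, Polynomial.coe_mul]
    ring
  have hΘq : (Θ (2 * m + 1) : PowerSeries O) =
      (Ωp (2 * m + 1) : PowerSeries O) * ((Θ (2 * m + 1) /ₘ Ωp (2 * m + 1) : O[X]) : PowerSeries O) := by
    rw [← Polynomial.coe_mul, mul_divByMonic_eq_of_dvd'' (hmon _) (hdiv m)]
  have hgq' : (gq m : PowerSeries O) =
      (-1) ^ (m + 1) * ((Θ (2 * m + 1) /ₘ Ωp (2 * m + 1) : O[X]) : PowerSeries O) := by
    rw [hgq]
    dsimp only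
    rw [Polynomial.coe_mul, Polynomial.coe_pow, Polynomial.coe_neg, Polynomial.coe_one]
  have hσ : ((-1 : PowerSeries O) ^ (m + 1)) * (-1) ^ (m + 1) = 1 := by
    rw [← mul_pow, neg_one_mul, neg_neg, one_pow]
  have hLQ' : L' - (gq m : PowerSeries O) =
      ((X : O[X]) : PowerSeries O) * (Ωm (2 * m + 1) : PowerSeries O) * Q := by
    rw [← Polynomial.coe_mul]
    exact hLQ
  have key := sub_mul_eq_of_identities' hσ hΘq hgq' hLQ' rfl
  rw [pow_zero, map_one, one_mul, hθ, hω, hιO, hιO, hΩ, ← map_mul, ← map_sub, ← map_mul, key]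

end Construction

end Summit.BirchSwinnertonDyer.BirchSwinnertonDyer.Theorems.ResidualThetaLayer

end
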